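/-
Copyright (c) 2026 the pub-hodgecm-mathlib formalisation cell (harness21).  Prover seat hodgecm-mathlib-K2E1-p10 (g5), Track B «K2-LIT», h413 = `stmt-HodgeConjecture-24833`,
R90-TF section S8 «ContSpec-n½», deal S8-R195 (i) ∕ ruling S8-R197 (§2 `exportsRow6_at_level`, twist brick (t2)): multiplication by a bounded measurable function as a continuous
linear operator on `L²(μ)`, and the TWIST of an `L²(μ)`-holomorphic family of classes by such a function — the brick that carries (E6) (the truncated `L²`-family of ★ (C2b)) through the
`det`-twist `Ec ↦ Ec·Θ` to the pair block (★ `truncation_twist` does the function-level half).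
-/
import Literature.NumberTheory.Automorphic.AutomorphicRepsGLCuspidalUnitary   -- ★ `AdelicGroupData.quotFun`, `continuous_quotFun` (the descent to `G(F)A_G∖G(𝔸)`)
import Mathlib.MeasureTheory.Function.LpSeminorm.Monotonicity
import Mathlib.MeasureTheory.Function.LpSpace.Basic
import Mathlib.Analysis.Calculus.FDeriv.Comp
import HarnessLib

/-!
# K2·E1 ∕ R90-TF S8 — `K2E1L2FamilyTwistU`: MULTIPLICATION BY A BOUNDED FUNCTION ON `L²(μ)` AND THE TWIST OF AN `L²`-HOLOMORPHIC FAMILY (rank- and group-generic)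

Track B ∕ K2-LIT, crux h413 = `stmt-HodgeConjecture-24833`, route of record `HCCMUnconditional`; cell `hodgecm-mathlib`, R90-TF section S8 (hCONT OF RECORD, ruling S8-R197: the
per-generator exports row at ADMISSIBLE levels is reached from ★ row 8 LEVEL by the `det`-twist; (E6) must twist too).  THEOREMS ONLY (no `def`, no `instance`, no notation, no
named-fact hypothesis, no `sorry`; default heartbeats); lane `--supports stmt-HodgeConjecture-24833 --as helper` (count-neutral).  CLOSES NO SOCKET.

THE MATHEMATICS (folklore; [MoeglinWaldspurger1995, I.2.13, IV.2]; [Rudin1991, Thm 3.31]).  For an a.e.-strongly-measurable `w` with `‖w‖ ≤ C` a.e., `f ↦ w·f` is a bounded operator on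
`L²(μ)` of norm `≤ C` (Mathlib `MemLp.of_le_mul`, `eLpNorm_le_mul_eLpNorm_of_ae_le_mul`); composing an `L²(μ)`-valued holomorphic family with it gives a holomorphic family
representing the pointwise products.  On an adelic quotient `𝔛 = G(F)A_G∖G(𝔸)` a continuous bounded left-`G(F)A_G`-invariant `θ` descends to the continuous bounded `quotFun θ`, and
`quotFun (E·θ) = quotFun E · quotFun θ` pointwise, so an `L²`-holomorphic family representing `quotFun (E z)` twists to one representing `quotFun (E z·θ)` — with ★
`truncation_twist` (`Λ^T(E·θ) = Λ^T(E)·θ`) this carries the truncated family (E6) of ★ `…_with_truncatedFamily` through the `det`-twist of ★ `chiPair_exports_of_witness`.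
* §1 `exists_mulCLM_of_norm_le` — the multiplication operator `M_w : L²(μ) →L[ℂ] L²(μ)`, `M_w f =ᵐ w·f`, `‖M_w f‖ ≤ max C 0·‖f‖`.
* §2 `exists_L2Family_mul` — `L²`-holomorphic families twist by `w`.
* §3 `exists_L2Family_quotFun_twist` — the adelic-quotient print: a family representing `quotFun (E z)` twists to one representing `quotFun (fun g => E z g * θ g)`.
HONEST LABEL: HC_CM is proved only modulo the 7 printed citations (2 remaining named inputs: hLiu418 = `stmt-HodgeConjecture-24832`, h413 = `stmt-HodgeConjecture-24833`) until rung 0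
closes; unconditional measure theory; count-neutral; closes no socket.

## References
* [MoeglinWaldspurger1995] C. Mœglin, J.-L. Waldspurger, *Spectral Decomposition and Eisenstein Series* (1995), I.2.13, IV.2.
* [Rudin1991] W. Rudin, *Functional Analysis*, 2nd ed. (1991), Thm 3.31.
-/

set_option autoImplicit false
set_option linter.dupNamespace false  -- the mandated namespace repeats the summit's segment (`HodgeConjecture.HodgeConjecture`)

noncomputable section

open MeasureTheory Filter Topology Set
open scoped ENNReal NNReal

namespace Summit.HodgeConjecture.HodgeConjecture.Cruxes.H413.K2E1L2FamilyTwistU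

/-! ## §1 Multiplication by a bounded function on `L²(μ)` -/

section Mul

variable {X : Type*} [MeasurableSpace X] (μ : Measure X)

/-- **THE MULTIPLICATION OPERATOR `M_w` ON `L²(μ)`**: for `w` a.e.-strongly measurable with `‖w x‖ ≤ C` a.e. there is a continuous linear `M_w : L²(μ) →L[ℂ] L²(μ)` with `M_w f = w·f`
a.e. for every `f` and `‖M_w f‖ ≤ max C 0 · ‖f‖` (Hölder `L∞ × L² → L²`, Mathlib `MemLp.of_le_mul` ∕ `eLpNorm_le_mul_eLpNorm_of_ae_le_mul`). [folklore] [cite: Rudin1991, Thm 3.31] -/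
theorem exists_mulCLM_of_norm_le {w : X → ℂ} (hw : AEStronglyMeasurable w μ) {C : ℝ} (hwC : ∀ᵐ x ∂μ, ‖w x‖ ≤ C) :
    ∃ M : Lp ℂ 2 μ →L[ℂ] Lp ℂ 2 μ, (∀ f : Lp ℂ 2 μ, ((M f : Lp ℂ 2 μ) : X → ℂ) =ᵐ[μ] fun x => w x * (f : X → ℂ) x) ∧
      ∀ f : Lp ℂ 2 μ, ‖M f‖ ≤ max C 0 * ‖f‖ := by
  -- the pointwise domination `‖w·f‖ ≤ max C 0 · ‖f‖`
  have hdom : ∀ f : Lp ℂ 2 μ, ∀ᵐ x ∂μ, ‖w x * (f : X → ℂ) x‖ ≤ max C 0 * ‖(f : X → ℂ) x‖ := fun f => by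
    filter_upwards [hwC] with x hx
    rw [norm_mul]
    exact mul_le_mul_of_nonneg_right (hx.trans (le_max_left _ _)) (norm_nonneg _)
  have hmem : ∀ f : Lp ℂ 2 μ, MemLp (fun x => w x * (f : X → ℂ) x) 2 μ := fun f =>
    MemLp.of_le_mul (Lp.memLp f) (hw.mul (Lp.aestronglyMeasurable f)) (hdom f)
  -- the linear map
  set T : Lp ℂ 2 μ →ₗ[ℂ] Lp ℂ 2 μ :=
    { toFun := fun f => (hmem f).toLp _
      map_add' := fun f g => by
        refine Lp.ext ?_
        filter_upwards [(hmem (f + g)).coeFn_toLp, Lp.coeFn_add ((hmem f).toLp _) ((hmem g).toLp _), (hmem f).coeFn_toLp, (hmem g).coeFn_toLp,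
          Lp.coeFn_add f g] with x h1 h2 h3 h4 h5
        rw [h1, h2, Pi.add_apply, h3, h4, h5, Pi.add_apply, mul_add]
      map_smul' := fun a f => by
        refine Lp.ext ?_
        filter_upwards [(hmem (a • f)).coeFn_toLp, Lp.coeFn_smul a ((hmem f).toLp _), (hmem f).coeFn_toLp, Lp.coeFn_smul a f] with x h1 h2 h3 h4
        rw [h1, RingHom.id_apply, h2, Pi.smul_apply, h3, h4, Pi.smul_apply, smul_eq_mul, smul_eq_mul]
        ring } with hT
  -- the norm bound
  have hbd : ∀ f : Lp ℂ 2 μ, ‖T f‖ ≤ max C 0 * ‖f‖ := fun f => by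
    have hle := eLpNorm_le_mul_eLpNorm_of_ae_le_mul (hdom f) 2
    have hfin : ENNReal.ofReal (max C 0) * eLpNorm (f : X → ℂ) 2 μ ≠ ∞ := ENNReal.mul_ne_top ENNReal.ofReal_ne_top (Lp.memLp f).eLpNorm_ne_top
    have h1 : ‖T f‖ = (eLpNorm (fun x => w x * (f : X → ℂ) x) 2 μ).toReal := by
      simp only [hT, LinearMap.coe_mk, AddHom.coe_mk, Lp.norm_toLp]
    rw [h1, Lp.norm_def, ← ENNReal.toReal_ofReal (le_max_right C 0), ← ENNReal.toReal_mul]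
    exact ENNReal.toReal_mono hfin hle
  refine ⟨T.mkContinuous (max C 0) hbd, fun f => ?_, fun f => ?_⟩
  · rw [LinearMap.mkContinuous_apply]
    exact (hmem f).coeFn_toLp
  · rw [LinearMap.mkContinuous_apply]
    exact hbd f

end Mul

/-! ## §2 Twisting an `L²`-holomorphic family by a bounded function -/

section Family

variable {X : Type*} [MeasurableSpace X] (μ : Measure X)

/-- **`L²`-HOLOMORPHIC FAMILIES TWIST BY BOUNDED FUNCTIONS**: if `Fam : ℂ → L²(μ)` is holomorphic on `D` and represents `f z` a.e. for `z ∈ D`, and `w` is a.e.-strongly measurable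
and a.e. bounded, then `M_w ∘ Fam` (§1) is holomorphic on `D` and represents `w · f z`. [folklore] [cite: Rudin1991, Thm 3.31] -/
theorem exists_L2Family_mul {w : X → ℂ} (hw : AEStronglyMeasurable w μ) {C : ℝ} (hwC : ∀ᵐ x ∂μ, ‖w x‖ ≤ C) {D : Set ℂ} (f : ℂ → X → ℂ)
    (hFam : ∃ Fam : ℂ → Lp ℂ 2 μ, DifferentiableOn ℂ Fam D ∧ ∀ z ∈ D, ((Fam z : Lp ℂ 2 μ) : X → ℂ) =ᵐ[μ] f z) :
    ∃ Fam' : ℂ → Lp ℂ 2 μ, DifferentiableOn ℂ Fam' D ∧ ∀ z ∈ D, ((Fam' z : Lp ℂ 2 μ) : X → ℂ) =ᵐ[μ] fun x => w x * f z x := by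
  obtain ⟨Fam, hFd, hFam⟩ := hFam
  obtain ⟨M, hM, -⟩ := exists_mulCLM_of_norm_le μ hw hwC
  refine ⟨fun z => M (Fam z), M.differentiable.comp_differentiableOn hFd, fun z hz => ?_⟩
  filter_upwards [hM (Fam z), hFam z hz] with x hx hfx
  rw [hx, hfx]

end Family

/-! ## §3 The adelic-quotient print: twisting a family representing `quotFun (E z)` by a continuous bounded invariant `θ` -/

section Quotient

open NumberField Literature.NumberTheory.Automorphic AdelicGroupData

variable {K : Type} [Field K] [NumberField K] (𝒢 : AdelicGroupData K) (μ : Measure 𝒢.automorphicQuotient)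

/-- `quotFun (E·θ) = quotFun E · quotFun θ` pointwise (definitional). [folklore] -/
theorem quotFun_mul (E θ : 𝒢.Adelic → ℂ) : 𝒢.quotFun (fun g => E g * θ g) = fun x => 𝒢.quotFun E x * 𝒢.quotFun θ x := rfl

/-- **TWIST OF A FAMILY OF CLASSES ON `𝔛 = G(F)A_G∖G(𝔸)`**: for `θ : G(𝔸) → ℂ` continuous, bounded (`‖θ‖ ≤ C`) and left-`G(F)A_G`-invariant, an `L²(μ)`-holomorphic family on `D`
representing `quotFun (E z)` a.e. yields one representing `quotFun (fun g => E z g * θ g)` (§2 with `w := quotFun θ`, continuous ★ `continuous_quotFun`, bounded) — the shape in which ★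
`truncation_twist` (`Λ^T(E·θ) = fun g => Λ^T(E) g * θ g`) delivers the twisted truncated family. [cite: MoeglinWaldspurger1995, I.2.13, IV.2] [cite: Rudin1991, Thm 3.31] -/
theorem exists_L2Family_quotFun_twist {θ : 𝒢.Adelic → ℂ} (hθc : Continuous θ) {C : ℝ} (hθC : ∀ g, ‖θ g‖ ≤ C)
    (hθinv : ∀ γ ∈ 𝒢.quotientSubgroup, ∀ g, θ (γ * g) = θ g) {D : Set ℂ} (E : ℂ → 𝒢.Adelic → ℂ)
    (hFam : ∃ Fam : ℂ → Lp ℂ 2 μ, DifferentiableOn ℂ Fam D ∧ ∀ z ∈ D, ((Fam z : Lp ℂ 2 μ) : 𝒢.automorphicQuotient → ℂ) =ᵐ[μ] 𝒢.quotFun (E z)) :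
    ∃ Fam' : ℂ → Lp ℂ 2 μ, DifferentiableOn ℂ Fam' D ∧
      ∀ z ∈ D, ((Fam' z : Lp ℂ 2 μ) : 𝒢.automorphicQuotient → ℂ) =ᵐ[μ] 𝒢.quotFun (fun g => E z g * θ g) := by
  have hw : AEStronglyMeasurable (𝒢.quotFun θ) μ := (continuous_quotFun hθinv hθc).aestronglyMeasurable
  have hwC : ∀ᵐ x ∂μ, ‖𝒢.quotFun θ x‖ ≤ C := Eventually.of_forall fun x => hθC _
  obtain ⟨Fam', hFd', hFam'⟩ := exists_L2Family_mul μ hw hwC (fun z => 𝒢.quotFun (E z)) hFam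
  refine ⟨Fam', hFd', fun z hz => ?_⟩
  filter_upwards [hFam' z hz] with x hx
  rw [hx, quotFun_mul, mul_comm]

end Quotient

end Summit.HodgeConjecture.HodgeConjecture.Cruxes.H413.K2E1L2FamilyTwistU

end
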